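import Mathlib
import Literature.Computability.AlgebraicComplexity.StandardFamilies
import Literature.Computability.AlgebraicComplexity.HessianAtOrigin
import Literature.Computability.AlgebraicComplexity.LandsbergRessayreNormalForm
import Literature.Computability.AlgebraicComplexity.MignonRessayreBound
import Summits.ValiantsHypothesis.ValiantsHypothesis.Theorems.RefutationDegreeBeyondHessianNsStubMrPointSmooth
import Summits.ValiantsHypothesis.ValiantsHypothesis.Theorems.RefutationDegreeBeyondHessianNsStubZariskiDense
import Summits.ValiantsHypothesis.ValiantsHypothesis.Theorems.RefutationDegreeBeyondHessianNsStubFanoClosed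
import Summits.ValiantsHypothesis.ValiantsHypothesis.Theorems.RefutationDegreeBeyondHessianNsStubKernelPlaneEval
import Summits.ValiantsHypothesis.ValiantsHypothesis.Theorems.RefutationDegreeBeyondHessianNsStubNoBigFlat

/-!
# Jet separation: the permanent's jet at the Mignon–Ressayre point is not a limit of jets of
# singular affine pencils of size `⌊n²/2⌋ + 1` (crux `BeyondHessianNs`, line `Sketch`, the EXISTENCE half)

Helper file for crux item stmt-ValiantsHypothesis-5641 (`RefutationDegree.BeyondHessianNs`), registered stub
`stub_jetSeparationMr` of the line `Sketch` (skeleton v11), and the existence half `E` of the line in the form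
registered as `stub_jetSeparation` in skeleton v9.

Let `n = p + 3 ≥ 55`, `m = ⌊n²/2⌋ + 1`, `Λ₀ = diag(0, 1, …, 1) ∈ ℂ^{m × m}` and `y₀ = J - n E₀₀` the Mignon–Ressayre
zero of `per_n`.  The JET VARIETY `𝒮_n ⊂ ℂ^{(Fin n × Fin n →₀ ℕ)}` is the set of coefficient vectors of the
polynomials `det(Λ₀ + Σ_e x_e Z_e)`, `Z ∈ (ℂ^{m × m})^{n × n}` — by the Landsberg–Ressayre normal form these are exactly
the translates `det A(x + y)` of the affine `m × m` pencils `A` with `A(y)` of corank one, and by the line's JET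
CALIBRATION (`…JetCalibrationTranslated.exists_refutation_of_jet_identity`) a polynomial of degree `D` in the
coefficients vanishing on `𝒮_n` and not at the jet `coeff per_n(x + y₀)` IS a Nullstellensatz refutation of
`Rep(n, m)` of degree `m (D + 1)`.  This file proves that such polynomials EXIST (with no degree bound):

* `stub_jetSeparationMr` — for `n ≥ 55` the coefficient vector of `per_n(x + y₀)` is NOT in the Zariski closure
  `zeroLocus (vanishingIdeal 𝒮_n)` of the jet variety;
* `jetSeparation` — hence (`y₀` is a smooth zero, `stub_mrPointSmooth`) the existence statement `E` of skeleton v9.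

Equivalently: the pointed affine border version of "`dc(per_n) > ⌊n²/2⌋ + 1`" holds at `y₀` — `per_n(x + y₀)` is not a
limit of determinants of affine pencils `Λ₀ + Z(x)`.

## Proof (composition of the landed stubs S2–S5 of skeleton v10)

Suppose the jet `𝔭` of `per_n(x + y₀)` lies in `zeroLocus (vanishingIdeal 𝒮_n)`.
* S2 `stub_zariskiDense` (Chevalley + the density theorem, via
  `Literature…OrbitClosureEuclidean.mem_closure_range_of_ker_bind₁_le`): the restriction of `𝔭` to the finite set of
  exponents of degree `≤ m` is a CLASSICAL limit of restricted jets of `𝒮_n`.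
* S4 `stub_kernelPlaneEval`: every jet `g = det(Λ₀ + Z(x))` vanishes identically on its kernel plane
  `{v : Z(v) e₀ = 0}`, a linear subspace of dimension `≥ n² - m`.
* S3 `stub_fanoClosed`: the set of coefficient vectors whose polynomial vanishes on SOME linear subspace of dimension
  `≥ k` is closed for the classical topology (orthonormal `k`-frames form a compact set; evaluation is jointly
  continuous).  Hence `per_n(y₀ + v) = 0` for all `v` in a linear `V` with `dim V ≥ n² - m = ⌈n²/2⌉ - 1`.
* S5 `stub_noBigFlat`: impossible for `n ≥ 55` — `W = ℂ y₀ + V` is a linear space through `y₀` inside `{per_n = 0}`,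
  and the sibling crux's flat bound `…BeyondHessianSosPlusTwo.nine_mul_finrank_flat_le` gives
  `9 dim W + 9 ≤ 4(n-1)² + 36(n-1) < 9 ⌈n²/2⌉`.
-/

noncomputable section

-- single-conjunct layout: Sub = Summit, duplicated namespace component intended
set_option linter.dupNamespace false

namespace Summit.ValiantsHypothesis.ValiantsHypothesis.Theorems.RefutationDegreeBeyondHessianNs

open MvPolynomial Matrix
open Literature.Computability.AlgebraicComplexity

/-- The determinant of the pencil `Λ₀ + Σ_e X_e Z_e` with constant part `Λ₀ = diag(0,1,…,1)` of size `⌊n²/2⌋ + 1`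
(local notation of the line). -/
local notation3 (prettyPrint := false) "pencilDet[" n ", " Z "]" =>
  (((Literature.Computability.AlgebraicComplexity.lamMatrix ℂ (0 : Fin (n ^ 2 / 2 + 1))).map MvPolynomial.C +
      ∑ e : Fin n × Fin n, (MvPolynomial.X e : MvPolynomial (Fin n × Fin n) ℂ) •
        (Z e).map (MvPolynomial.C : ℂ →+* MvPolynomial (Fin n × Fin n) ℂ) :
      Matrix (Fin (n ^ 2 / 2 + 1)) (Fin (n ^ 2 / 2 + 1)) (MvPolynomial (Fin n × Fin n) ℂ)).det)

/-- The jet variety of the line at size `m = ⌊n²/2⌋ + 1`: coefficient vectors of `det(Λ₀ + Σ_e x_e Z_e)`,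
`Z ∈ (ℂ^{m×m})^{n×n}` (local notation of the line). -/
local notation3 (prettyPrint := false) "jetVariety[" n "]" =>
  Set.range (fun Z : Fin n × Fin n → Matrix (Fin (n ^ 2 / 2 + 1)) (Fin (n ^ 2 / 2 + 1)) ℂ =>
    fun μ : Fin n × Fin n →₀ ℕ => MvPolynomial.coeff μ
      (((Literature.Computability.AlgebraicComplexity.lamMatrix ℂ (0 : Fin (n ^ 2 / 2 + 1))).map MvPolynomial.C +
        ∑ e : Fin n × Fin n, (MvPolynomial.X e : MvPolynomial (Fin n × Fin n) ℂ) •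
          (Z e).map (MvPolynomial.C : ℂ →+* MvPolynomial (Fin n × Fin n) ℂ) :
          Matrix (Fin (n ^ 2 / 2 + 1)) (Fin (n ^ 2 / 2 + 1)) (MvPolynomial (Fin n × Fin n) ℂ)).det))

/-- The finite set of exponents of degree `≤ ⌊n²/2⌋ + 1` on the `n × n` variables (local notation of the line). -/
local notation3 (prettyPrint := false) "degLE[" n "]" =>
  ((Finset.range (n ^ 2 / 2 + 1 + 1)).biUnion
    (fun k => (Finset.univ : Finset (Fin n × Fin n)).finsuppAntidiag k))

/-- **Jet separation at the Mignon–Ressayre point** (registered stub `stub_jetSeparationMr` of line `Sketch`): for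
`n = p + 3 ≥ 55`, the coefficient vector of `per_n(X + y₀)` lies OUTSIDE the Zariski closure of the jet variety
`{coeff det(Λ₀ + Σ_e X_e Z_e) : Z ∈ (ℂ^{m×m})^{n×n}}`, `m = ⌊n²/2⌋ + 1` — i.e. some polynomial in the coefficients
vanishes on all these determinants and not at the permanent's jet.  (Composition of S2 `stub_zariskiDense`,
S4 `stub_kernelPlaneEval`, S3 `stub_fanoClosed`, S5 `stub_noBigFlat`; module docstring.) -/
theorem stub_jetSeparationMr : ∀ (p : ℕ), 52 ≤ p → (fun μ : Fin (p + 3) × Fin (p + 3) →₀ ℕ => MvPolynomial.coeff μ (Literature.Computability.AlgebraicComplexity.transl (Literature.Computability.AlgebraicComplexity.mrPoint ℂ p) (Literature.Computability.AlgebraicComplexity.perPoly (Fin (p + 3)) ℂ))) ∉ MvPolynomial.zeroLocus ℂ (MvPolynomial.vanishingIdeal ℂ (jetVariety[p + 3])) := by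
  intro p hp hmem
  -- Zariski closure ⊂ classical closure, on the exponents of degree `≤ m`
  have hcl := stub_zariskiDense (p + 3) (degLE[p + 3]) _ hmem
  -- every jet of the jet variety vanishes on a plane of dimension `≥ n² - m`; pass to the limit
  obtain ⟨V, hkV, hV⟩ := stub_fanoClosed (degLE[p + 3]) ((p + 3) ^ 2 - ((p + 3) ^ 2 / 2 + 1)) _
    (by
      rintro c ⟨Z, rfl⟩
      obtain ⟨V, hV1, hV2⟩ := stub_kernelPlaneEval (p + 3) Z
      exact ⟨V, Nat.sub_le_iff_le_add.mpr hV1, hV2⟩) _ hcl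
  -- a flat of dimension `≥ ⌈n²/2⌉ - 1` through `y₀`: impossible for `n ≥ 55`
  exact stub_noBigFlat p hp V (Nat.sub_le_iff_le_add.mp hkV) hV

/-- **E — jet separation, the existence half of line `Sketch`** (the statement registered as `stub_jetSeparation` in
skeleton v9): for all `n ≥ 55` there is a smooth zero `y` of `per_n` (namely `y₀`) such that the coefficient vector of
`per_n(X + y)` lies OUTSIDE the Zariski closure of the jet variety at size `⌊n²/2⌋ + 1`.  Consequently separating
polynomials `Ψ` (vanishing on all `coeff det(Λ₀ + Σ_e X_e Z_e)`, non-zero at the permanent's jet) EXIST; by the jet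
calibration each is a Nullstellensatz refutation of `Rep(n, ⌊n²/2⌋ + 1)` of degree `(⌊n²/2⌋ + 1)(deg Ψ + 1)`, and the
crux `BeyondHessianNs` is exactly the assertion that `deg Ψ` can be taken polynomial in `n`. -/
theorem jetSeparation : ∃ n₀ : ℕ, ∀ n ≥ n₀,
    ∃ (y : Fin n × Fin n → ℂ) (e : Fin n × Fin n),
      MvPolynomial.eval y (Literature.Computability.AlgebraicComplexity.perPoly (Fin n) ℂ) = 0 ∧
      MvPolynomial.eval y (MvPolynomial.pderiv e
        (Literature.Computability.AlgebraicComplexity.perPoly (Fin n) ℂ)) ≠ 0 ∧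
      (fun μ : Fin n × Fin n →₀ ℕ => MvPolynomial.coeff μ
        (Literature.Computability.AlgebraicComplexity.transl y
          (Literature.Computability.AlgebraicComplexity.perPoly (Fin n) ℂ))) ∉
        MvPolynomial.zeroLocus ℂ (MvPolynomial.vanishingIdeal ℂ (jetVariety[n])) := by
  refine ⟨55, fun n hn => ?_⟩
  obtain ⟨p, rfl⟩ : ∃ p, n = p + 3 := ⟨n - 3, by omega⟩
  obtain ⟨e, he⟩ := stub_mrPointSmooth p
  exact ⟨mrPoint ℂ p, e, eval_mrPoint_perPoly, he, stub_jetSeparationMr p (by omega)⟩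

end Summit.ValiantsHypothesis.ValiantsHypothesis.Theorems.RefutationDegreeBeyondHessianNs

end
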